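import Literature.AnabelianGeometry.SemiGraphs.Prop44iTowerGenuine
import Literature.AnabelianGeometry.SemiGraphs.GraphCoveringDegreeOne
import Literature.AnabelianGeometry.SemiGraphs.AmbientVocabEmbedding
import Literature.AnabelianGeometry.SemiGraphs.CuspOmissionSubgraph
import HarnessLib

/-!
# [SemiAnbd] Prop 4.4 (i) at the profinite carriers: the EMBEDDING transported to the connected pieces of the COVERING
# semi-graph of the pull-back — `𝔾_H ×_{𝔾_K} 𝔾′ ≅ 𝔾'_{ψ^*S_π}` as semi-graphs, compatibly with the second projections (proof-only)

Mochizuki, *Semi-graphs of anabelioids*, Publ. RIMS **42** (2006), §4 Prop 4.4 (i) p. 54 («the induced morphism `H̃ → K̃` from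
any connected component `H̃` of the pull-back of this finite étale covering to `H` is an embedding» — print's `H′`, `K′` written
`H̃`, `K̃` throughout this file to avoid a clash with its primed semi-graph variables `𝔾′`, `B′`, `e′`; PRIMS render
`paper:doi-10-2977-prims-1166642064` p0061 l.23–27), Def 4.1 (ii) p. 50 (an *embedding* of semi-graphs of anabelioids: «Any
locally trivial morphism … whose underlying morphism of semi-graphs is an … embedding»; PRIMS p0056 l.43–45), §1 p. 12
(embeddings of semi-graphs, sub-semi-graphs (a)–(c)), §1 p. 14 (pull-back of semi-graphs), Rmk 3.5.1 p. 37 (kurims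
`paper:url-f33ace170ff4`). [cite: MochizukiSemiAnbd2006, Prop 4.4 (i), p. 54]

PROOF-ONLY (cell abc-iut, layer L3, seat abc-iut-f-161 gen 9, row «(2d) EMBEDDING TRANSPORT»; no definition, no instance, no
named fact).  abc-iut-f-161 g8 FILE D (`Prop44iGraphStepGenuine`) proved that the point lift
`L : 𝔾_H ×_{𝔾_K} 𝔾′ → 𝔾'_{ψ^*S_π}` (`S_π = CovObj.ofSemiGraphCovering π` for a proper excision `π : 𝔾′ → 𝔾_K`) is BIJECTIVE on
vertices and edges and compatible with the second projections on vertices and edges, and stated «embedding» for the connected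
sub-semi-graphs of the PULL-BACK SEMI-GRAPH.  Here the statement is moved to where print has it — the connected pieces of the
covering semi-graph `𝔾'_{ψ^*S_π}` of the pulled-back covering, mapped by the underlying morphism of `𝒢'_{ψ^*S_π} → 𝒢_{S_π}`:
* §1 `pullbackLift_abuts_eq_none` (properness of `π`: a pair of branches abutting to no vertex goes to a branch-orbit abutting to
  no vertex), `pullbackLift_branchMap_bijective`, **`pullbackLift_isIso`** — `L` is an ISOMORPHISM of semi-graphs
  (abc-iut-L3-t3's `SemiGraph.Hom.isoOfBijective`);
* §2 `pullbackLift_covPullbackSnd_branchMap` — compatibility with the second projections ON BRANCHES (both composites lie over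
  the same branch of `𝔾_K`; the covering's structure map is injective on the branches of an edge), hence the SQUARE
  `L ≫ (covPullbackSnd).base = pullback.snd ≫ (𝔾′ ≅ 𝔾_{S_π})` as an equation of morphisms of semi-graphs (`pullbackLift_comp_covPullbackSnd_base`);
* §3 **`isEmbedding_ι_covPullbackSnd_base`** — if every connected sub-semi-graph of `𝔾_H ×_{𝔾_K} 𝔾′` embeds into `𝔾′` by the
  second projection (Thm 1.2 (ii) shape), then EVERY CONNECTED sub-semi-graph `C` of the covering semi-graph `𝔾'_{ψ^*S_π}`
  EMBEDS into `𝔾_{S_π}` by `C ↪ 𝔾'_{ψ^*S_π} → 𝔾_{S_π}` (transport along the isomorphism of §1: preimage sub-semi-graph, connectedness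
  by a surjective restriction, the §1 p.12 characterisation `SemiGraph.isEmbedding_iff_injective`);
* §4 **`prop44i_embedding_of_isQuasiCoherent`** — abc-iut-f-161 g9's `Hom.prop44i_of_isQuasiCoherent` RESTATED AT THE COVERING:
  for `ψ : H → K` (`𝔾_H`, `𝔾_K` finite, `H` totally aloof, `K` quasi-coherent, `ψ` locally open with injective constituents) there is
  a finite tempered `S₀ ∈ B^cov(K)` and, for every family of 2-cells `θ₀` of `ψ₀ : 𝒢'_{ψ^*S₀} → 𝒢_{S₀}`, a finite graph-covering
  `π : B′ → 𝔾_{S₀}` such that the arrow `𝒢''_{ψ₀^*S_π} → 𝒢_{S_π}` is LOCALLY TRIVIAL and its underlying morphism restricted to EVERY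
  CONNECTED sub-semi-graph of `𝔾''_{ψ₀^*S_π}` is an EMBEDDING of semi-graphs — i.e. an «embedding» in the sense of Def 4.1 (ii) on
  each connected component of the pull-back covering, along the finite étale tower `𝒢_{S_π} → 𝒢_{S₀} → K`.
WHAT IS NOT CLAIMED: the one-object presentation of the tower by a single `S ∈ B^cov(K)`; the `Loc(𝔾, Γ)` dressing (hypotheses
displayed, as in `Prop44iTowerGenuine`).  Nothing printed is asserted beyond the tree's Thm 1.2 (ii); no side taken on [IUTchIII] Cor. 3.12.
-/

noncomputable section

namespace Literature.AnabelianGeometry.SemiGraphs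

open CategoryTheory

universe u

namespace ProfiniteSemiGraph

namespace Hom

variable {H K : ProfiniteSemiGraph.{u}} (ψ : Hom H K) (θ : ψ.ConjugatorFamily) {B' : SemiGraph.{u}}
  (π : B' ⟶ K.graph) (hπ : SemiGraph.IsExcision π) (hB' : SemiGraph.IsProper π)
  [∀ v, Countable (SemiGraph.Hom.VertexFiber π v)] [∀ e, Countable (SemiGraph.Hom.EdgeFiber π e)]

/-! ## §1. The point lift `𝔾_H ×_{𝔾_K} 𝔾′ → 𝔾'_{ψ^*S_π}` is an isomorphism of semi-graphs -/

/-- **Branches abutting to no vertex go to branch-orbits abutting to no vertex** (properness of `π`): if the pair `(b, b′)` abuts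
to no vertex of the pull-back then `b` abuts to no vertex of `𝔾_H` — for if `b` abutted to `w`, the branch `b′` of `𝔾′` over
`ψ b` would (π proper) abut to a vertex over `ψ w`, and the pair would abut. [cite: MochizukiSemiAnbd2006, §1 p.14] -/
theorem pullbackLift_abuts_eq_none (β : (SemiGraph.pullback ψ.base π).Branch)
    (hβ : (SemiGraph.pullback ψ.base π).abuts β = none) :
    ((ψ.covPullbackWith θ).obj (CovObj.ofSemiGraphCovering π hπ hB')).coveringSemiGraph.abuts
      ((((ψ.covPullbackWith θ).obj (CovObj.ofSemiGraphCovering π hπ hB')).pointLift (SemiGraph.pullback.fst ψ.base π) _ _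
        (ψ.pullback_glueCondition θ π hπ hB')).branchMap β) = none := by
  have hA : H.graph.abuts β.1.1 = none := by
    by_contra hne
    obtain ⟨w, hw⟩ := Option.ne_none_iff_exists'.mp hne
    obtain ⟨v', hv', hvv⟩ := hB'.exists_abuts_of_branchMap_eq (ψ.base.abuts_branchMap β.1.1 w hw) β.2.symm
    change ((H.graph.abuts β.1.1).bind _) = none at hβ
    simp only [hw, hv', Option.bind_some, dif_pos hvv.symm] at hβ
    exact Option.some_ne_none _ hβ
  rw [CovObj.pointLift_branchMap]
  have key : ∀ (o : Option H.graph.Vertex) (ho : H.graph.abuts β.1.1 = o)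
      (ω : BTemp.Orbits (((ψ.covPullbackWith θ).obj (CovObj.ofSemiGraphCovering π hπ hB')).SE (H.graph.edgeOf β.1.1))),
      o = none → ((ψ.covPullbackWith θ).obj (CovObj.ofSemiGraphCovering π hπ hB')).coveringAbutsAux β.1.1 o ho ω = none := by
    rintro (_ | w) ho ω hnone
    · rfl
    · exact absurd hnone (Option.some_ne_none w)
  exact key _ rfl _ hA

/-- The point lift is bijective on branches (two branches per edge; bijective on edges by FILE D).
[cite: MochizukiSemiAnbd2006, §1 p.11] -/
theorem pullbackLift_branchMap_bijective :
    Function.Bijective (((ψ.covPullbackWith θ).obj (CovObj.ofSemiGraphCovering π hπ hB')).pointLift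
      (SemiGraph.pullback.fst ψ.base π) _ _ (ψ.pullback_glueCondition θ π hπ hB')).branchMap :=
  CovObj.pointLift_branchMap_bijective _ _ _ _ _ (ψ.pullbackLift_edgeMap_bijective θ π hπ hB')

/-- **`𝔾_H ×_{𝔾_K} 𝔾′ ≅ 𝔾'_{ψ^*S_π}`**: the point lift is an isomorphism of semi-graphs — print's «connected components of the
pull-back» of the covering ARE the connected pieces of the pull-back semi-graph, as semi-graphs. [cite: MochizukiSemiAnbd2006, Prop 4.4 (i), p. 54] -/
theorem pullbackLift_isIso :
    CategoryTheory.IsIso (((ψ.covPullbackWith θ).obj (CovObj.ofSemiGraphCovering π hπ hB')).pointLift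
      (SemiGraph.pullback.fst ψ.base π) _ _ (ψ.pullback_glueCondition θ π hπ hB')) :=
  (SemiGraph.Hom.isoOfBijective
    (((ψ.covPullbackWith θ).obj (CovObj.ofSemiGraphCovering π hπ hB')).pointLift
      (SemiGraph.pullback.fst ψ.base π) _ _ (ψ.pullback_glueCondition θ π hπ hB'))
    (pullbackLift_vertexMap_bijective ψ θ π hπ hB') (pullbackLift_edgeMap_bijective ψ θ π hπ hB')
    (pullbackLift_branchMap_bijective ψ θ π hπ hB') (pullbackLift_abuts_eq_none ψ θ π hπ hB')).isIso_hom

/-! ## §2. Compatibility with the second projections on branches; the square of morphisms of semi-graphs -/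

/-- **Compatibility with the second projections, on branches**: both `snd.base (L β)` and `(𝔾′ ≅ 𝔾_{S_π}) (pullback.snd β)` are
branches of the same edge of `𝔾_{S_π}` lying over the branch `ψ b = π b′` of `𝔾_K`, and `𝔾_{S_π} → 𝔾_K` is injective on the
branches of an edge. [cite: MochizukiSemiAnbd2006, Prop 4.4 (i), p. 54] -/
theorem pullbackLift_covPullbackSnd_branchMap (β : (SemiGraph.pullback ψ.base π).Branch) :
    (ψ.covPullbackSnd θ (CovObj.ofSemiGraphCovering π hπ hB')).base.branchMap
        ((((ψ.covPullbackWith θ).obj (CovObj.ofSemiGraphCovering π hπ hB')).pointLift (SemiGraph.pullback.fst ψ.base π) _ _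
          (ψ.pullback_glueCondition θ π hπ hB')).branchMap β) =
      (CovObj.ofSemiGraphCovering_graphIso π hπ hB').hom.branchMap ((SemiGraph.pullback.snd ψ.base π).branchMap β) := by
  apply (CovObj.ofSemiGraphCovering π hπ hB').coveringHom.base.branchMap_injOn
  · -- same edge of `𝔾_{S_π}`
    rw [SemiGraph.Hom.edgeOf_branchMap, SemiGraph.Hom.edgeOf_branchMap, SemiGraph.Hom.edgeOf_branchMap,
      SemiGraph.Hom.edgeOf_branchMap, ψ.pullbackLift_covPullbackSnd_edgeMap θ π hπ hB']
  · -- same branch of `𝔾_K`: `ψ b = π b′`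
    have h1 := congrArg (fun φ : SemiGraph.pullback ψ.base π ⟶ K.graph => φ.branchMap β)
      (show (((ψ.covPullbackWith θ).obj (CovObj.ofSemiGraphCovering π hπ hB')).pointLift (SemiGraph.pullback.fst ψ.base π) _ _
            (ψ.pullback_glueCondition θ π hπ hB') ≫ (ψ.covPullbackSnd θ (CovObj.ofSemiGraphCovering π hπ hB')).base) ≫
          (show (CovObj.ofSemiGraphCovering π hπ hB').coveringGraph.graph ⟶ K.graph
            from (CovObj.ofSemiGraphCovering π hπ hB').coveringHom.base) =
        SemiGraph.pullback.fst ψ.base π ≫ ψ.base by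
        rw [Category.assoc, covPullbackSnd_base_comp, ← Category.assoc, pullbackLift_comp_base])
    have h2 := congrArg (fun φ : SemiGraph.pullback ψ.base π ⟶ K.graph => φ.branchMap β)
      (show (SemiGraph.pullback.snd ψ.base π ≫ (CovObj.ofSemiGraphCovering_graphIso π hπ hB').hom) ≫
          (show (CovObj.ofSemiGraphCovering π hπ hB').coveringGraph.graph ⟶ K.graph
            from (CovObj.ofSemiGraphCovering π hπ hB').coveringHom.base) =
        SemiGraph.pullback.fst ψ.base π ≫ ψ.base by
        rw [Category.assoc, CovObj.ofSemiGraphCovering_graphIso_hom_comp, SemiGraph.pullback.condition])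
    exact h1.trans h2.symm

/-- **THE SQUARE of morphisms of semi-graphs**: point lift then second projection of the fibre square equals second
projection of the pull-back then `𝔾′ ≅ 𝔾_{S_π}`. [cite: MochizukiSemiAnbd2006, Prop 4.4 (i), p. 54] -/
theorem pullbackLift_comp_covPullbackSnd_base :
    ((ψ.covPullbackWith θ).obj (CovObj.ofSemiGraphCovering π hπ hB')).pointLift (SemiGraph.pullback.fst ψ.base π) _ _
        (ψ.pullback_glueCondition θ π hπ hB') ≫ (ψ.covPullbackSnd θ (CovObj.ofSemiGraphCovering π hπ hB')).base =
      SemiGraph.pullback.snd ψ.base π ≫ (CovObj.ofSemiGraphCovering_graphIso π hπ hB').hom :=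
  SemiGraph.hom_ext _ _ (funext fun ν => ψ.pullbackLift_covPullbackSnd_vertexMap θ π hπ hB' ν)
    (funext fun ε => ψ.pullbackLift_covPullbackSnd_edgeMap θ π hπ hB' ε)
    (funext fun β => ψ.pullbackLift_covPullbackSnd_branchMap θ π hπ hB' β)

/-! ## §3. Transport of «embedding» to the connected pieces of the covering semi-graph -/

/-- **Embedding of the connected pieces of the COVERING semi-graph `𝔾'_{ψ^*S_π}` into `𝔾_{S_π}`**, transported from the pull-back
semi-graph along the isomorphism of §1 and the square of §2: if every connected sub-semi-graph of `𝔾_H ×_{𝔾_K} 𝔾′` embeds into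
`𝔾′` by the second projection, then for every connected sub-semi-graph `C` of `𝔾'_{ψ^*S_π}` the composite
`C ↪ 𝔾'_{ψ^*S_π} → 𝔾_{S_π}` (underlying morphism of `𝒢'_{ψ^*S_π} → 𝒢_{S_π}`) is an embedding of semi-graphs.
[cite: MochizukiSemiAnbd2006, Prop 4.4 (i), p. 54] -/
theorem isEmbedding_ι_covPullbackSnd_base
    (hemb : ∀ C : (SemiGraph.pullback ψ.base π).Subgraph, C.toSemiGraph.IsConnected →
      SemiGraph.IsEmbedding (C.ι ≫ SemiGraph.pullback.snd ψ.base π))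
    (C : ((ψ.covPullbackWith θ).obj (CovObj.ofSemiGraphCovering π hπ hB')).coveringSemiGraph.Subgraph)
    (hC : C.toSemiGraph.IsConnected) :
    SemiGraph.IsEmbedding (C.ι ≫ (ψ.covPullbackSnd θ (CovObj.ofSemiGraphCovering π hπ hB')).base) := by
  classical
  -- notation
  haveI := ψ.pullbackLift_isIso θ π hπ hB'
  set L := ((ψ.covPullbackWith θ).obj (CovObj.ofSemiGraphCovering π hπ hB')).pointLift (SemiGraph.pullback.fst ψ.base π) _ _
    (ψ.pullback_glueCondition θ π hπ hB')
  set snd := (ψ.covPullbackSnd θ (CovObj.ofSemiGraphCovering π hπ hB')).base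
  set gI := CovObj.ofSemiGraphCovering_graphIso π hπ hB'
  let e : SemiGraph.pullback ψ.base π ≅ ((ψ.covPullbackWith θ).obj (CovObj.ofSemiGraphCovering π hπ hB')).coveringSemiGraph :=
    asIso L
  have hsq : e.hom ≫ snd = SemiGraph.pullback.snd ψ.base π ≫ gI.hom := ψ.pullbackLift_comp_covPullbackSnd_base θ π hπ hB'
  -- `e.hom ∘ e.inv = id` on the three sorts
  have hVih : ∀ x, e.hom.vertexMap (e.inv.vertexMap x) = x := fun x =>
    SemiGraph.Iso.inv_vertexMap_hom_vertexMap e.symm x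
  have hEih : ∀ x, e.hom.edgeMap (e.inv.edgeMap x) = x := fun x =>
    SemiGraph.Iso.inv_edgeMap_hom_edgeMap e.symm x
  have hBih : ∀ x, e.hom.branchMap (e.inv.branchMap x) = x := fun x =>
    SemiGraph.Iso.inv_branchMap_hom_branchMap e.symm x
  -- the square, pointwise after `e.inv`
  have hsqV : ∀ x, snd.vertexMap x = gI.hom.vertexMap ((SemiGraph.pullback.snd ψ.base π).vertexMap (e.inv.vertexMap x)) := by
    intro x
    have := congrArg (fun φ : SemiGraph.pullback ψ.base π ⟶ (CovObj.ofSemiGraphCovering π hπ hB').coveringSemiGraph =>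
      φ.vertexMap (e.inv.vertexMap x)) hsq
    simpa [hVih] using this
  have hsqE : ∀ x, snd.edgeMap x = gI.hom.edgeMap ((SemiGraph.pullback.snd ψ.base π).edgeMap (e.inv.edgeMap x)) := by
    intro x
    have := congrArg (fun φ : SemiGraph.pullback ψ.base π ⟶ (CovObj.ofSemiGraphCovering π hπ hB').coveringSemiGraph =>
      φ.edgeMap (e.inv.edgeMap x)) hsq
    simpa [hEih] using this
  have hsqB : ∀ x, snd.branchMap x = gI.hom.branchMap ((SemiGraph.pullback.snd ψ.base π).branchMap (e.inv.branchMap x)) := by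
    intro x
    have := congrArg (fun φ : SemiGraph.pullback ψ.base π ⟶ (CovObj.ofSemiGraphCovering π hπ hB').coveringSemiGraph =>
      φ.branchMap (e.inv.branchMap x)) hsq
    simpa [hBih] using this
  -- the preimage sub-semi-graph of the pull-back
  let D : (SemiGraph.pullback ψ.base π).Subgraph :=
    { verts := e.hom.vertexMap ⁻¹' C.verts, edges := e.hom.edgeMap ⁻¹' C.edges }
  -- `e.inv` restricted: `C → D`, surjective on vertices, edges and branches
  let g : C.toSemiGraph ⟶ D.toSemiGraph :=
    { vertexMap := fun x => ⟨e.inv.vertexMap x.1, show e.hom.vertexMap _ ∈ C.verts by rw [hVih]; exact x.2⟩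
      edgeMap := fun x => ⟨e.inv.edgeMap x.1, show e.hom.edgeMap _ ∈ C.edges by rw [hEih]; exact x.2⟩
      branchMap := fun b => ⟨e.inv.branchMap b.1, show e.hom.edgeMap _ ∈ C.edges by
        rw [e.inv.edgeOf_branchMap, hEih]; exact b.2⟩
      edgeOf_branchMap := fun b => Subtype.ext (by
        change (SemiGraph.pullback ψ.base π).edgeOf (e.inv.branchMap b.1) = e.inv.edgeMap (C.toSemiGraph.edgeOf b).1
        rw [e.inv.edgeOf_branchMap]; rfl)
      branchMap_injOn := fun b₁ b₂ _ h => by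
        apply Subtype.ext
        have h' : e.inv.branchMap b₁.1 = e.inv.branchMap b₂.1 := congrArg Subtype.val h
        rw [← SemiGraph.Iso.inv_branchMap_hom_branchMap e.symm b₁.1, ← SemiGraph.Iso.inv_branchMap_hom_branchMap e.symm b₂.1]
        exact congrArg e.symm.inv.branchMap h'
      abuts_branchMap := fun b x h => by
        rw [SemiGraph.Subgraph.abuts_eq_some_iff] at h ⊢
        exact e.inv.abuts_branchMap _ _ h }
  have hgV : Function.Surjective g.vertexMap := fun y =>
    ⟨⟨e.hom.vertexMap y.1, y.2⟩, Subtype.ext (SemiGraph.Iso.inv_vertexMap_hom_vertexMap e y.1)⟩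
  have hgE : Function.Surjective g.edgeMap := fun y =>
    ⟨⟨e.hom.edgeMap y.1, y.2⟩, Subtype.ext (SemiGraph.Iso.inv_edgeMap_hom_edgeMap e y.1)⟩
  have hgB : Function.Surjective g.branchMap := fun y =>
    ⟨⟨e.hom.branchMap y.1, show _ ∈ C.edges by rw [e.hom.edgeOf_branchMap]; exact y.2⟩,
      Subtype.ext (SemiGraph.Iso.inv_branchMap_hom_branchMap e y.1)⟩
  have hD : D.toSemiGraph.IsConnected := SemiGraph.IsConnected.of_hom_surjective g hgV hgE hgB hC
  -- the embedding of `D` into `𝔾′`, unpacked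
  obtain ⟨hinjV, hinjE, hrefl⟩ := (SemiGraph.isEmbedding_iff_injective _).mp (hemb D hD)
  have hgIV : Function.Injective gI.hom.vertexMap := fun a b h => by
    rw [← SemiGraph.Iso.inv_vertexMap_hom_vertexMap gI a, h, SemiGraph.Iso.inv_vertexMap_hom_vertexMap]
  have hgIE : Function.Injective gI.hom.edgeMap := fun a b h => by
    rw [← SemiGraph.Iso.inv_edgeMap_hom_edgeMap gI a, h, SemiGraph.Iso.inv_edgeMap_hom_edgeMap]
  refine (SemiGraph.isEmbedding_iff_injective _).mpr ⟨?_, ?_, ?_⟩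
  · -- injective on vertices
    intro x₁ x₂ h
    change snd.vertexMap x₁.1 = snd.vertexMap x₂.1 at h
    rw [hsqV, hsqV] at h
    have h' : g.vertexMap x₁ = g.vertexMap x₂ := @hinjV (g.vertexMap x₁) (g.vertexMap x₂) (hgIV h)
    have : e.inv.vertexMap x₁.1 = e.inv.vertexMap x₂.1 := congrArg Subtype.val h'
    apply Subtype.ext
    rw [← hVih x₁.1, ← hVih x₂.1, this]
  · -- injective on edges
    intro x₁ x₂ h
    change snd.edgeMap x₁.1 = snd.edgeMap x₂.1 at h
    rw [hsqE, hsqE] at h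
    have h' : g.edgeMap x₁ = g.edgeMap x₂ := @hinjE (g.edgeMap x₁) (g.edgeMap x₂) (hgIE h)
    have : e.inv.edgeMap x₁.1 = e.inv.edgeMap x₂.1 := congrArg Subtype.val h'
    apply Subtype.ext
    rw [← hEih x₁.1, ← hEih x₂.1, this]
  · -- reflects abutment
    intro c x h
    rw [SemiGraph.Subgraph.abuts_eq_some_iff]
    have h' : (CovObj.ofSemiGraphCovering π hπ hB').coveringSemiGraph.abuts (snd.branchMap c.1) =
        some (snd.vertexMap x.1) := h
    rw [hsqB, hsqV] at h'
    -- reflect along the isomorphism `gI`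
    have h1 : B'.abuts ((SemiGraph.pullback.snd ψ.base π).branchMap (e.inv.branchMap c.1)) =
        some ((SemiGraph.pullback.snd ψ.base π).vertexMap (e.inv.vertexMap x.1)) := by
      have := gI.inv.abuts_branchMap _ _ h'
      rwa [SemiGraph.Iso.inv_branchMap_hom_branchMap, SemiGraph.Iso.inv_vertexMap_hom_vertexMap] at this
    -- reflect along the embedding of `D`
    have h2 : D.toSemiGraph.abuts (g.branchMap c) = some (g.vertexMap x) := hrefl (g.branchMap c) (g.vertexMap x) h1
    rw [SemiGraph.Subgraph.abuts_eq_some_iff] at h2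
    -- push forward along `e.hom`
    have h3 := e.hom.abuts_branchMap _ _ h2
    change ((ψ.covPullbackWith θ).obj (CovObj.ofSemiGraphCovering π hπ hB')).coveringSemiGraph.abuts
      (e.hom.branchMap (e.inv.branchMap c.1)) = some (e.hom.vertexMap (e.inv.vertexMap x.1)) at h3
    rwa [hBih, hVih] at h3

end Hom

/-! ## §4. Prop 4.4 (i) at the covering: «embedding» (Def 4.1 (ii)) on every connected component of the pull-back covering -/

namespace Hom

variable {H K : ProfiniteSemiGraph.{u}} (ψ : Hom H K) (θ : ψ.ConjugatorFamily)

/-- **Prop 4.4 (i), GENUINE at the profinite carriers, stated at the COVERING semi-graph.**  For `ψ : H → K` with `𝔾_H`, `𝔾_K`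
finite, `H` totally aloof, `K` quasi-coherent and `ψ` locally open with injective constituents: there is a finite tempered
`S₀ ∈ B^cov(K)` with nonempty fibres over which `ψ₀ : 𝒢'_{ψ^*S₀} → 𝒢_{S₀}` is locally trivial with immersive base, and for every
family of 2-cells `θ₀` of `ψ₀` a FINITE semi-graph `B′` with a finite graph-covering `π : B′ → 𝔾_{S₀}` such that — `S_π` finite and
locally trivial — the arrow of covering semi-graphs of anabelioids `𝒢''_{ψ₀^*S_π} → 𝒢_{S_π}` is LOCALLY TRIVIAL and its underlying
morphism of semi-graphs restricted to EVERY CONNECTED sub-semi-graph of `𝔾''_{ψ₀^*S_π}` is an EMBEDDING: «the induced morphism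
`H̃ → K̃` from any connected component `H̃` of the pull-back … is an embedding» (print's `H′ → K′`, `H′`; Def 4.1 (ii)) with
`K̃ := 𝒢_{S_π}` at the top of the finite étale tower `𝒢_{S_π} → 𝒢_{S₀} → K`.  Displayed scope: hypotheses as listed (print:
finite objects of `Loc(𝔾, Γ)`);
the tower is not repackaged as one object of `B^cov(K)`. [cite: MochizukiSemiAnbd2006, Prop 4.4 (i), p. 54] -/
theorem prop44i_embedding_of_isQuasiCoherent (hH : H.graph.IsFinite) (hK : K.graph.IsFinite) (hHa : H.IsTotallyAloof)
    (hqc : K.IsQuasiCoherent) (hψ : ψ.IsLocallyOpen)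
    (hinjV : ∀ w, Function.Injective (ψ.hV w)) (hinjE : ∀ e', Function.Injective (ψ.hE e')) :
    ∃ S₀ : CovObj K, S₀.IsFinite ∧ S₀.HasNonemptyFibres ∧ S₀.IsTempered ∧
      (ψ.covPullbackSnd θ S₀).IsLocallyTrivial ∧ SemiGraph.IsImmersion (ψ.covPullbackSnd θ S₀).base ∧
      ∀ θ₀ : (ψ.covPullbackSnd θ S₀).ConjugatorFamily,
      ∃ (B' : SemiGraph.{u}) (π : B' ⟶ S₀.coveringGraph.graph) (hπ : SemiGraph.IsExcision π) (hp : SemiGraph.IsProper π)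
        (_ : ∀ v, Countable (SemiGraph.Hom.VertexFiber π v)) (_ : ∀ e, Countable (SemiGraph.Hom.EdgeFiber π e)),
        B'.IsFinite ∧ SemiGraph.IsFiniteGraphCovering π ∧
        (CovObj.ofSemiGraphCovering π hπ hp).IsFinite ∧ (CovObj.ofSemiGraphCovering π hπ hp).IsLocallyTrivial ∧
        ((ψ.covPullbackSnd θ S₀).covPullbackSnd θ₀ (CovObj.ofSemiGraphCovering π hπ hp)).IsLocallyTrivial ∧
        ∀ C : ((((ψ.covPullbackSnd θ S₀).covPullbackWith θ₀).obj (CovObj.ofSemiGraphCovering π hπ hp)).coveringSemiGraph).Subgraph,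
          C.toSemiGraph.IsConnected →
            SemiGraph.IsEmbedding (C.ι ≫ ((ψ.covPullbackSnd θ S₀).covPullbackSnd θ₀ (CovObj.ofSemiGraphCovering π hπ hp)).base) := by
  obtain ⟨S₀, hfin, hne, htemp, hlt, himm, hrest⟩ := ψ.prop44i_of_isQuasiCoherent θ hH hK hHa hqc hψ hinjV hinjE
  refine ⟨S₀, hfin, hne, htemp, hlt, himm, fun θ₀ => ?_⟩
  obtain ⟨B', π, hπ, hp, hcV, hcE, hB', hfgc, hfin₁, hlt₁, -, hlt₂, -, -, hemb⟩ := hrest θ₀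
  exact ⟨B', π, hπ, hp, hcV, hcE, hB', hfgc, hfin₁, hlt₁, hlt₂, fun C hC =>
    (ψ.covPullbackSnd θ S₀).isEmbedding_ι_covPullbackSnd_base θ₀ π hπ hp hemb C hC⟩

end Hom

end ProfiniteSemiGraph

end Literature.AnabelianGeometry.SemiGraphs

end
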